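import Literature.IUT.HodgeTheaters.GaloisValDatumCoveringMonoidEquivalence
import HarnessLib

/-!
# B16 closer, part 3 (ε): the monoid `𝒪^▷(T_{G/V})` of the GENUINE `C⊢_v` IS the `V`-invariants `M^V` of the GENUINE
# `C⊢_v` covering monoid `𝒪^×_{K̄_v}·q̲^ℕ ↶ G_v`, naturally in `G/V ∈ B(K_v)⁰`

Mochizuki, *Inter-universal Teichmüller Theory I*, kurims manuscript (May 2020), Ex. 3.2 (iv)–(v) pp. 71–72: «`Φ_{C⊢_v} :=
ℕ·log_Φ(q̲_v)|_{D⊢_v}` … a `p_v`-adic Frobenioid», «`𝒪^▷(−) = 𝒪^×(−)·q̲_v^ℕ`» (transported form of (v) «`A^Θ ↦ 𝒪^×(T_{A^Θ})·Θ̲_v^ℕ`»)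
[cite: Mochizuki2012, I Ex 3.2 (iv)(v) pp.71-72]; *… II*, Def. 4.9 (i) p. 154 «by evaluating the monoid `𝒪^▷(−)` on `D` … at [a universal
covering pro-object] `A`, we thus obtain a monoid equipped with a natural action by `G`» [cite: Mochizuki2012, II Def 4.9 (i) p.154]
(D-0012 claim key, status disputed; nothing of the series is asserted); [FrdII] Ex. 1.1 (ii) p. 8 [cite: MochizukiFrdII2008, Ex 1.1 (ii) p.8];
[FrdI] Prop. 2.2 p. 45 (the monoid `𝒪^▷(A)` of a Frobenius-trivial object) [cite: MochizukiFrdI2008, Prop. 2.2 p.45].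

Cell abc-iut, MERGE-MAP register row **B16**, item «ε — effSubmonoid identification» (the residual named by abc-iut-L5-t2 gen 6/7:
«the objectwise isomorphism of `PadicFrd.Datum.effSubmonoid` of the [FrdII] data `GaloisValDatum.dashDatum` … with the stages»), seat
abc-iut-L6-t7 gen 5 (the register's writer), sequel of p475634 (`betaApp_bijective`, `comparison_isEquivalence`).  DEF-BEARING,
minimal: `toEff` (`MonoidHom`), `effEquiv` / `badEffEquiv` (`MulEquiv`), `effMonoidIso` (natural isomorphism of functors); 0 instances /
notation / `Prop` facts; nothing landed is edited.
Consumed BY NAME: abc-iut-L5-t2's `PadicFrd.Datum.effSubmonoid` / `mem_effSubmonoid_iff` / `effMap` / `coe_effMap` (p440826),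
`dashCoveringMonoid` / `invariantUnitOfIsUnit` / `toΩInvariant` / `betaApp(_of)` / `pairHom` / `gpPowHom_apply` / `bZeroHom`,
`fieldFunctor_isPadicLocal`, `valuation_fixedFld_eq_one_iff`; abc-iut-L1's `divZeroHom_intNonzeroToUnits` / `ker_divZeroHom_eq_unitSubgroup`
/ `Monogenic.BSub`; THIS seat's `betaApp_injective` / `betaApp_eq_iff_betaAmb_eq` / `betaAmb_of` / `bZeroHom_toΩInvariant` /
`coe_coe_bZeroHom_invariantUnit` / `dashOrd_unit_mul_pow` / `gpPowHom_eq_of_dashOrd_eq` / `betaApp_natural` (p475634).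

WHAT THIS FILE CONSTRUCTS / PROVES (`M := d.dashCoveringMonoid q`, `hq : ¬ IsUnit q`, `X = G/V`):
* `betaApp_of_mem_effSubmonoid` — `β[x]` is EFFECTIVE for `x ∈ M^V` (`Div_B β[x] = [log_Φ(q̲)^{ord x}] ∈ Φ_{C⊢_v}(G/V)`);
* `exists_betaApp_of_eq_of_mem_effSubmonoid` — every effective `b = (u, [log^n]) ∈ 𝒪^▷(T_{G/V}) ⊆ B^c(G/V)` is `β[w·q̲^n]` for the
  `V`-invariant unit `w := u·c^{-n} ∈ 𝒪^×_{Ω^V}` (abc-iut-L1's `ker_divZeroHom_eq_unitSubgroup` at the `p`-adic local `Ω^V`);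
* `toEff hq X : M^V →* 𝒪^▷(T_{G/V})`, **`effEquiv hq X : M^V ≃* 𝒪^▷(T_{G/V})`** (`= (d.dashDatum hq).effSubmonoid X`) — injective by
  `betaApp_injective` + `eq_of_bZeroHom_eq`, surjective by the previous item; `coe_effEquiv` (its value in `B^c` is `β[x]`);
* **NATURALITY `effMap_effEquiv`**: along `f : G/U → G/V`, abc-iut-L5-t2's restriction `𝒪^▷(T_{G/V}) → 𝒪^▷(T_{G/U})` (`Datum.effMap`)
  matches (A)'s pull-back `M^V → M^U` (`betaApp_natural`) — i.e. `G/V ↦ M^V` IS the monoid `𝒪^▷(−)` of the genuine `C⊢_v` on `B(K_v)⁰`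
  ([IUTchII] Def. 4.9 (i) «evaluating `𝒪^▷(−)` … at the universal covering» read backwards); packaged as the natural isomorphism
  **`effMonoidIso : (d.dashCoveringMonoid q).invariantsFunctor ≅ (d.dashDatum hq).effMonoid`**;
* at the genuine datum: **`InitialThetaData.badEffEquiv`** (`M^V` of `D.badCoveringMonoidAt` ≃* `𝒪^▷(T_{G/V})` of `D.badCdashAt`).
HONEST FRAMING: valuation/Galois bookkeeping over typed interfaces; with p475634 this CLOSES MERGE-MAP B16 (no residual at the monoid
or Frobenioid level); NOT a Kummer structure, NOT the disputed comparison; no side taken on [IUTchIII] Cor. 3.12; typed ≠ proved elsewhere.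
-/

noncomputable section

open scoped Classical

namespace Literature.IUT.HodgeTheaters

open CategoryTheory Opposite Function Literature.AnabelianGeometry.SemiGraphs Literature.AlgebraicGeometry.Frobenioids
  Literature.AlgebraicGeometry.Frobenioids.PadicFrd Literature.IUT.HodgeArakelov

universe u

namespace GaloisValDatum

variable {p : ℕ} [Fact p.Prime] (d : GaloisValDatum.{u} p) {q : intNonzero d.k} (hq : ¬ IsUnit q)

/-! ### 1. `β[x]` is effective -/

/-- The divisor `Div_B` of the monogenic datum on an element of `B^c(G/V)` is its `(Φ^c)^gp`-coordinate (bookkeeping).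
[cite: MochizukiFrdII2008, Ex 1.1 (ii) p.8] -/
theorem divB_dashDatum_apply (X : CosetCat d.Gal) (b : (d.dashDatum hq).B.obj (op X)) :
    AlgebraicGeometry.Frobenioids.divB (d.dashDatum hq).Φ (d.dashDatum hq).B (d.dashDatum hq).divB (op X) b =
      (Subtype.val b).2 := rfl

/-- **`β[x] ∈ 𝒪^▷(T_{G/V})`** for `x = u·q̲^n ∈ M^V`: its divisor is `[log_Φ(q̲)^n] ∈ Φ_{C⊢_v}(G/V)`.
[cite: Mochizuki2012, I Ex 3.2 (v) p.72] -/
theorem betaApp_of_mem_effSubmonoid (X : CosetCat d.Gal) (x : (d.dashCoveringMonoid q).invariants (X.sg : Subgroup d.Gal)) :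
    d.betaApp hq X (Algebra.GrothendieckGroup.of x) ∈ (d.dashDatum hq).effSubmonoid X := by
  refine ((d.dashDatum hq).mem_effSubmonoid_iff _).mpr ⟨d.divisorObjEquiv hq X (Associates.mk x), ?_⟩
  rw [divB_dashDatum_apply, betaApp_of_eq]
  exact d.gpPowHom_apply hq X x

/-! ### 2. Every effective element of `B^c(G/V)` is a `β[x]` -/

/-- **Every element of `𝒪^▷(T_{G/V})` is `β[w·q̲^n]`**: for `b = (u, [log^n])` effective, `Div₀(u·c^{-n}) = 1`, so `w := u·c^{-n}` is a
`V`-invariant unit of `𝒪^▷_{K̄_v}` (abc-iut-L1's `ker_divZeroHom_eq_unitSubgroup` at the `p`-adic local field `Ω^V`) and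
`β[w·q̲^n] = b`. [cite: Mochizuki2012, I Ex 3.2 (v) p.72] -/
theorem exists_betaApp_of_eq_of_mem_effSubmonoid (X : CosetCat d.Gal) (b : (d.dashDatum hq).B.obj (op X))
    (hb : b ∈ (d.dashDatum hq).effSubmonoid X) :
    ∃ x : (d.dashCoveringMonoid q).invariants (X.sg : Subgroup d.Gal), d.betaApp hq X (Algebra.GrothendieckGroup.of x) = b := by
  obtain ⟨s, hs⟩ := ((d.dashDatum hq).mem_effSubmonoid_iff b).mp hb
  obtain ⟨⟨u, γ⟩, hmemb⟩ := b
  change ((d.fieldFunctor.obj X).K)ˣ at u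
  change Algebra.GrothendieckGroup ↥(Submonoid.powers (Monogenic.gen d.fieldFunctor (d.relEmb.img q) X)) at γ
  change ↥(Submonoid.powers (Monogenic.gen d.fieldFunctor (d.relEmb.img q) X)) at s
  have hγ : γ = Algebra.GrothendieckGroup.of s := hs
  obtain ⟨n, hn⟩ := (Submonoid.mem_powers_iff _ _).mp s.2
  -- the `p`-adic local structure of `Ω^V`
  obtain ⟨⟨inst, hfin, hc⟩⟩ := d.fieldFunctor_isPadicLocal X
  letI := inst
  haveI := hfin
  set c : ((d.fieldFunctor.obj X).K)ˣ := intNonzeroToUnits (d.fieldFunctor.obj X).K (d.relEmb.img q X) with hcdef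
  have hcdiv : divZeroHom (d.fieldFunctor.obj X).K c =
      Algebra.GrothendieckGroup.of (Monogenic.gen d.fieldFunctor (d.relEmb.img q) X) :=
    divZeroHom_intNonzeroToUnits _ _
  -- the fibre-product condition: `Div₀(u) = [log]^n`
  have hmem : divZeroHom (d.fieldFunctor.obj X).K u =
      MonGp.map (Submonoid.powers (Monogenic.gen d.fieldFunctor (d.relEmb.img q) X)).subtype γ := hmemb
  have hγ' : MonGp.map (Submonoid.powers (Monogenic.gen d.fieldFunctor (d.relEmb.img q) X)).subtype γ =
      Algebra.GrothendieckGroup.of (Monogenic.gen d.fieldFunctor (d.relEmb.img q) X) ^ n := by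
    rw [hγ]
    simp only [MonGp.map_of, Submonoid.subtype_apply, ← hn, map_pow]
  -- `u·c^{-n}` has trivial divisor, hence is a unit of `𝒪_{Ω^V}`
  have hdiv : divZeroHom (d.fieldFunctor.obj X).K (u * (c ^ n)⁻¹) = 1 :=
    calc divZeroHom (d.fieldFunctor.obj X).K (u * (c ^ n)⁻¹)
        = divZeroHom (d.fieldFunctor.obj X).K u * (divZeroHom (d.fieldFunctor.obj X).K c ^ n)⁻¹ := by
          simp only [map_mul, map_inv, map_pow]
      _ = Algebra.GrothendieckGroup.of (Monogenic.gen d.fieldFunctor (d.relEmb.img q) X) ^ n *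
            (Algebra.GrothendieckGroup.of (Monogenic.gen d.fieldFunctor (d.relEmb.img q) X) ^ n)⁻¹ :=
          congrArg₂ (fun x y => x * (y ^ n)⁻¹) (hmem.trans hγ') hcdiv
      _ = 1 := by simp only [mul_inv_cancel]
  have hw₀ : u * (c ^ n)⁻¹ ∈ unitSubgroup (d.fieldFunctor.obj X).K := by
    rw [← ker_divZeroHom_eq_unitSubgroup hc, MonoidHom.mem_ker]
    exact hdiv
  have hv1 : ValuativeRel.valuation (d.fieldFunctor.obj X).K ((u * (c ^ n)⁻¹ : ((d.fieldFunctor.obj X).K)ˣ) :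
      (d.fieldFunctor.obj X).K) = 1 :=
    (mem_unitSubgroup_iff ((d.fieldFunctor.obj X).K)).mp hw₀
  have hval : ValuativeRel.valuation d.Ω
      (Subtype.val ((u * (c ^ n)⁻¹ : ((d.fieldFunctor.obj X).K)ˣ) : (d.fieldFunctor.obj X).K)) = 1 :=
    (d.valuation_fixedFld_eq_one_iff X _).mp hv1
  have hwmem : Subtype.val ((u * (c ^ n)⁻¹ : ((d.fieldFunctor.obj X).K)ˣ) : (d.fieldFunctor.obj X).K) ∈ intNonzero d.Ω := by
    refine ⟨le_of_eq hval, fun h0 => ?_⟩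
    rw [h0, map_zero] at hval
    exact zero_ne_one hval
  have hwU : IsUnit (⟨_, hwmem⟩ : intNonzero d.Ω) := (isUnit_intNonzero_iff d.Ω _).mpr hval
  have hV : ∀ σ ∈ (X.sg : Subgroup d.Gal), d.galAct σ ⟨_, hwmem⟩ = ⟨_, hwmem⟩ := fun σ hσ =>
    Subtype.ext ((IntermediateField.mem_fixedField_iff _ _).mp
      ((u * (c ^ n)⁻¹ : ((d.fieldFunctor.obj X).K)ˣ) : (d.fieldFunctor.obj X).K).2 σ hσ)
  -- the preimage `w·q̲^n`
  let wM := d.invariantUnitOfIsUnit (q := q) (X.sg : Subgroup d.Gal) ⟨_, hwmem⟩ hwU hV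
  let x : (d.dashCoveringMonoid q).invariants (X.sg : Subgroup d.Gal) :=
    (wM : (d.dashCoveringMonoid q).invariants (X.sg : Subgroup d.Gal)) * d.toΩInvariant q (X.sg : Subgroup d.Gal) ^ n
  refine ⟨x, ?_⟩
  rw [betaApp_eq_iff_betaAmb_eq, betaAmb_of]
  change d.pairHom hq X x = (u, γ)
  have hwM : d.bZeroHom X (wM : (d.dashCoveringMonoid q).invariants (X.sg : Subgroup d.Gal)) = u * (c ^ n)⁻¹ :=
    Units.ext (Subtype.ext (d.coe_coe_bZeroHom_invariantUnit X _ hwU hV))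
  refine Prod.ext ?_ ?_
  · change d.bZeroHom X ((wM : (d.dashCoveringMonoid q).invariants (X.sg : Subgroup d.Gal)) *
      d.toΩInvariant q (X.sg : Subgroup d.Gal) ^ n) = u
    simp only [map_mul, map_pow, hwM, bZeroHom_toΩInvariant, hcdef, inv_mul_cancel_right]
  · change d.gpPowHom hq X x = γ
    rw [hγ]
    exact d.gpPowHom_eq_of_dashOrd_eq hq X x (d.dashOrd_unit_mul_pow hq X wM n) s hn

/-! ### 3. `M^V ≃* 𝒪^▷(T_{G/V})`, naturally in `G/V` -/

/-- `M^V →* 𝒪^▷(T_{G/V})`, `x ↦ β[x]`. [cite: Mochizuki2012, I Ex 3.2 (v) p.72] -/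
def toEff (X : CosetCat d.Gal) :
    ↥((d.dashCoveringMonoid q).invariants (X.sg : Subgroup d.Gal)) →* ↥((d.dashDatum hq).effSubmonoid X) where
  toFun x := ⟨d.betaApp hq X (Algebra.GrothendieckGroup.of x), d.betaApp_of_mem_effSubmonoid hq X x⟩
  map_one' := Subtype.ext (by
    change d.betaApp hq X (Algebra.GrothendieckGroup.of 1) = 1
    rw [map_one, map_one])
  map_mul' x y := Subtype.ext (by
    change d.betaApp hq X (Algebra.GrothendieckGroup.of (x * y)) =
      d.betaApp hq X (Algebra.GrothendieckGroup.of x) * d.betaApp hq X (Algebra.GrothendieckGroup.of y)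
    rw [map_mul, map_mul])

/-- Values of `toEff` in `B^c(G/V)`. [cite: Mochizuki2012, I Ex 3.2 (v) p.72] -/
theorem coe_toEff (X : CosetCat d.Gal) (x : (d.dashCoveringMonoid q).invariants (X.sg : Subgroup d.Gal)) :
    ((d.toEff hq X x : (d.dashDatum hq).effSubmonoid X) : (d.dashDatum hq).B.obj (op X)) =
      d.betaApp hq X (Algebra.GrothendieckGroup.of x) := rfl

/-- `toEff` is injective (`β` is injective and `[x]` determines `x ∈ M^V` through its `B₀`-coordinate).
[cite: MochizukiFrdI2008, Cor. 5.4 p.104] -/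
theorem toEff_injective (X : CosetCat d.Gal) : Injective (d.toEff hq X) := by
  intro x y h
  have h1 : d.betaApp hq X (Algebra.GrothendieckGroup.of x) = d.betaApp hq X (Algebra.GrothendieckGroup.of y) :=
    congrArg Subtype.val h
  have h2 : d.pairHom hq X x = d.pairHom hq X y := by
    rw [← betaAmb_of, ← betaAmb_of]
    exact (d.betaApp_eq_iff_betaAmb_eq hq X _ _).mp h1 ▸ rfl
  exact d.eq_of_bZeroHom_eq X (congrArg Prod.fst h2)

/-- `toEff` is surjective (`exists_betaApp_of_eq_of_mem_effSubmonoid`). [cite: Mochizuki2012, I Ex 3.2 (v) p.72] -/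
theorem toEff_surjective (X : CosetCat d.Gal) : Surjective (d.toEff hq X) := by
  intro b
  obtain ⟨x, hx⟩ := d.exists_betaApp_of_eq_of_mem_effSubmonoid hq X b.1 b.2
  exact ⟨x, Subtype.ext hx⟩

/-- **`M^V ≃* 𝒪^▷(T_{G/V})`**: the `V`-invariants of the GENUINE `C⊢_v` covering monoid `𝒪^×_{K̄_v}·q̲^ℕ` (abc-iut-L5-t2 p456702) ARE the
monoid `𝒪^▷(T_{G/V})` (abc-iut-L5-t2's `Datum.effSubmonoid`, p440826) of the GENUINE `C⊢_v` — [IUTchII] Def. 4.9 (i)'s «evaluating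
`𝒪^▷(−)` at the universal covering» read backwards, objectwise. [cite: Mochizuki2012, II Def 4.9 (i) p.154] -/
def effEquiv (X : CosetCat d.Gal) :
    ↥((d.dashCoveringMonoid q).invariants (X.sg : Subgroup d.Gal)) ≃* ↥((d.dashDatum hq).effSubmonoid X) :=
  MulEquiv.ofBijective (d.toEff hq X) ⟨d.toEff_injective hq X, d.toEff_surjective hq X⟩

/-- Values of `effEquiv` in `B^c(G/V)`: `β[x]`. [cite: Mochizuki2012, I Ex 3.2 (v) p.72] -/
theorem coe_effEquiv (X : CosetCat d.Gal) (x : (d.dashCoveringMonoid q).invariants (X.sg : Subgroup d.Gal)) :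
    ((d.effEquiv hq X x : (d.dashDatum hq).effSubmonoid X) : (d.dashDatum hq).B.obj (op X)) =
      d.betaApp hq X (Algebra.GrothendieckGroup.of x) := rfl

/-- **NATURALITY**: along `f : G/U → G/V` (A)'s pull-back `M^V → M^U` matches abc-iut-L5-t2's restriction map
`𝒪^▷(T_{G/V}) → 𝒪^▷(T_{G/U})` of the genuine `C⊢_v` (`Datum.effMap`) — `G/V ↦ M^V` IS the monoid `𝒪^▷(−)` of `C⊢_v` on `B(K_v)⁰`.
[cite: Mochizuki2012, II Def 4.9 (i) p.154] -/
theorem effMap_effEquiv {X Y : CosetCat d.Gal} (f : X ⟶ Y) (y : (d.dashCoveringMonoid q).invariants (Y.sg : Subgroup d.Gal)) :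
    (d.dashDatum hq).effMap f (d.effEquiv hq Y y) = d.effEquiv hq X ((d.dashCoveringMonoid q).pull f y) := by
  apply Subtype.ext
  rw [Datum.coe_effMap]
  change (Monogenic.BMap d.fieldFunctor (d.relEmb.isConstantSection hq) f.op) (d.betaApp hq Y (Algebra.GrothendieckGroup.of y)) =
    d.betaApp hq X (Algebra.GrothendieckGroup.of ((d.dashCoveringMonoid q).pull f y))
  have h := DFunLike.congr_fun (d.betaApp_natural hq f) (Algebra.GrothendieckGroup.of y)
  rw [MonoidHom.comp_apply, MonoidHom.comp_apply, MonGp.map_of] at h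
  exact h.symm

/-- **Functor level: `(G/V ↦ M^V) ≅ (G/V ↦ 𝒪^▷(T_{G/V}))`** — (A)'s monoid of invariants of the genuine covering monoid
(abc-iut-w4-d019's `invariantsFunctor`) IS abc-iut-L5-t2's monoid `𝒪^▷(−)` (`Datum.effMonoid`) of the GENUINE `C⊢_v`, as functors
`(CosetCat G_v)ᵒᵖ ⥤ CommMonCat` (components `effEquiv`, naturality `effMap_effEquiv`). [cite: Mochizuki2012, II Def 4.9 (i) p.154] -/
def effMonoidIso : (d.dashCoveringMonoid q).invariantsFunctor ≅ (d.dashDatum hq).effMonoid :=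
  NatIso.ofComponents (fun X => (d.effEquiv hq (unop X)).toCommMonCatIso) fun {X Y} f => by
    apply CommMonCat.hom_ext
    refine MonoidHom.ext fun x => ?_
    exact (d.effMap_effEquiv hq f.unop x).symm

/-- Components of `effMonoidIso`. [cite: Mochizuki2012, II Def 4.9 (i) p.154] -/
theorem effMonoidIso_hom_app_apply (X : (CosetCat d.Gal)ᵒᵖ)
    (x : (d.dashCoveringMonoid q).invariants ((unop X).sg : Subgroup d.Gal)) :
    ((d.effMonoidIso hq).hom.app X).hom x = d.effEquiv hq (unop X) x := rfl

/-- Units correspond: `x ∈ M^V` is a unit iff `β[x] ∈ 𝒪^▷(T_{G/V})` is (`effEquiv` is a monoid isomorphism) — print's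
«`𝒪^×(−) ⊆ 𝒪^▷(−)`, the submonoid of invertible elements». [cite: Mochizuki2012, I Ex 3.2 (v) p.72] -/
theorem isUnit_effEquiv_iff (X : CosetCat d.Gal) (x : (d.dashCoveringMonoid q).invariants (X.sg : Subgroup d.Gal)) :
    IsUnit (d.effEquiv hq X x) ↔ IsUnit x :=
  MulEquiv.isUnit_map (d.effEquiv hq X)

end GaloisValDatum

/-! ### 4. At the genuine datum -/

namespace InitialThetaData

open NumberField IsDedekindDomain

variable {F K Fbar : Type} [Field F] [NumberField F] [Field K] [NumberField K] [Algebra F K]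
  [Field Fbar] [Algebra F Fbar] [Algebra K Fbar] [IsScalarTower F K Fbar] {E : WeierstrassCurve F}
  [E.IsElliptic] {l : ℕ} {Pb : BadPlacePredicates K} (D : InitialThetaData F K Fbar E l Pb)
  {v : FinitePlace F} (hv : v ∈ D.VFbad) (w : HeightOneSpectrum (𝓞 K)) [w.asIdeal.LiesOver v.maximalIdeal.asIdeal]
  (p : ℕ) [Fact p.Prime] (hw : ((p : ℕ) : 𝓞 K) ∈ w.asIdeal)

/-- **At the genuine datum**: the `V`-invariants of `D.badCoveringMonoidAt hv w p hw` (`𝒪^×_{K̄_w}·q̲_v̲^ℕ ↶ Gal(K̄_w/K_w)`) ARE the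
monoid `𝒪^▷(T_{G/V})` of the GENUINE `C⊢_v̲ = D.badCdashAt hv w p hw`, for every `G/V ∈ B(K_v̲)⁰`. [claim: Mochizuki2012, status: disputed] -/
def badEffEquiv (X : CosetCat (GaloisValDatum.ofPlace K p w hw).Gal) :
    ↥((D.badCoveringMonoidAt hv w p hw).invariants (X.sg : Subgroup (GaloisValDatum.ofPlace K p w hw).Gal)) ≃*
      ↥(((GaloisValDatum.ofPlace K p w hw).dashDatum (D.qRootAt_not_isUnit hv w p hw)).effSubmonoid X) :=
  (GaloisValDatum.ofPlace K p w hw).effEquiv (D.qRootAt_not_isUnit hv w p hw) X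

end InitialThetaData

end Literature.IUT.HodgeTheaters

end
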